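import Summits.BirchSwinnertonDyer.Rank1Residual.Additive.SplitMultiplicativeBaseChange
import Literature.NumberTheory.EllipticCurves.MultiplicativeUnramifiedTorsionProofs
import Literature.NumberTheory.EllipticCurves.NeronComponentIndexSplitProofs
import Literature.NumberTheory.DiophantineGeometry.MinimalDiscriminantNormProofs
import Literature.NumberTheory.DiophantineGeometry.EllArithGlue
import Mathlib.NumberTheory.RamificationInertia.Valuation
import HarnessLib

/-!
# The Tamagawa witness at EVERY split multiplicative place `v ∤ p` with `p ∣ c_v`, modulo Tate's
# uniformisation only — the (L1) input of the budget programme is ALREADY a tree theorem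
# (cell `b2b-bsdres`, team n1011, seat p01 GEN 3; row T-L1-KN; consumers: n1011-p10's
# T-E3g-BUDn / T-E3g-BUDn-W `hwitn`, n1011-p16's T-BUD5-K sockets)

HONEST FRAMING (cell `b2b-bsdres`, run/shared/lean/b2b/bsd-rank1-residual/, verbatim in every
file): the goal of the cell is to DELETE the COMBINATION-SHAPED residual classes of the
Birch–Swinnerton-Dyer formula for ALL analytic-rank `≤ 1` elliptic curves over `ℚ` — "full BSD
formula for every rank `≤ 1` curve in class `C`" assembled STRICTLY from published theorems — so
that the rank-`≤ 1` remainder becomes exactly the CONSTRUCTION-SHAPED classes, which are TYPED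
(missing-input `Prop`s), NOT attempted. This is not "finishing BSD". Team n1011 (N10 / N11, the
Route-G budget node): research route; no claim beyond the stated classes; nothing is booked; marks
UNCHANGED. THEOREMS ONLY: no definition, no named fact, no `sorry`; Tate's uniformisation enters
as the hypothesis `hU : Silverman1994_thmV53_tateUniformisation` (named fact A40, as in every Tate
file of the cell), so nothing here is conditional on anything else.

## What

n1011-p16's `TateDataUnramifiedTorsion.lean` reduced the split-multiplicative Tamagawa witness
`∃ u ∈ H¹_ur(K_v, E[p]), u ∉ 𝓚_v` (the per-place binder `hwit` / `hwitn` of n1011-p10's budget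
sockets `exists_finset_layerZero_of_tamagawaWitnesses`, `budgetLeLambdaAt_layer_of_tamagawaWitnesses`)
to ONE statement, recorded there and in the cell's ledger as the open input **(L1)**: *at a
multiplicative `v ∤ p` with `p ∣ ord_v(Δ_min)` the inertia group acts trivially on `E[p]`*.  That
statement IS in the tree — `WeierstrassCurve.smul_eq_of_mem_inertia_of_hasMultiplicativeReductionAt_of_dvd`
(`Literature/NumberTheory/EllipticCurves/MultiplicativeUnramifiedTorsionProofs.lean`, proved
"without the Tate curve" from Kodaira–Néron over `K_v^nr`; Serre 1972 n° 1.12, Serre 1987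
(4.1.12)).  This file does the bookkeeping that turns it into the witness:

* `forall_absInertia_smul_eq_of_dvd_ordMinimalDiscriminant` — (L1) in the `absInertia` currency of
  the budget files (`𝔐.inertia Γ_{K_v} = absInertia K_v`, tree `inertia_eq_absInertia`);
* `dvd_ordMinimalDiscriminant_of_dvd_localTamagawaNumber` — at a SPLIT multiplicative `v` the
  census datum `p ∣ c_v` is `p ∣ ord_v(Δ_min)` (tree
  `localTamagawaNumber_eq_ordMinimalDiscriminant_of_hasSplitMultiplicativeReductionAt`,
  Silverman *ATAEC* IV.9.2 (d));
* `exists_mem_unramifiedSubgroup_not_mem_kummerLocalConditionAt_of_tateUniformisation_of_split_of_dvd_localTamagawaNumber`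
  — **for `E` over ANY number field `K`, `p` prime, `v ∤ p` split multiplicative with `p ∣ c_v`:
  granted A40, `∃ u ∈ H¹_ur(K_v, E[p])`, `u ∉ 𝓚_v`** — n1011-p16's
  `…_of_tateUniformisation_of_dvd_localTamagawaNumber` (p273532) WITHOUT its hypothesis
  `hμ : μ_p(K_v) = 1`, i.e. also at the Tamagawa places with `N(v) ≡ 1 (mod p)` (over `ℚ`:
  `ℓ ≡ 1 (mod p)`), which were the "(L1) residual scope" of rows T-BUD5-K / T-E3g-BUDn-W;
* `ordMinimalDiscriminant_baseChange_eq_mul_of_hasSplitMultiplicativeReductionAt` — for `V/ℚ`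
  globally minimal, split multiplicative at the place `v`, `K` a number field and `𝔭 ∣ v`:
  `ord_𝔭 Δ_min(V ⊗ K) = e(𝔭|v) · ord_v Δ_min(V)` (the `ℤ`-minimal equation stays minimal at `𝔭`,
  additive-p2's `isMinimalAt_and_hasMultiplicativeReductionAt_baseChange_of_mult`; Mathlib
  `IsDedekindDomain.HeightOneSpectrum.valuation_liesOver`);
* `exists_mem_unramifiedSubgroup_not_mem_kummerLocalConditionAt_baseChange_of_split_of_dvd_localTamagawaNumber`
  — **the level-`K` witness from the census datum OVER `ℚ`**: `V/ℚ` globally minimal, `v ∤ p`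
  split multiplicative with `p ∣ c_v(V/ℚ)`, `K` ANY number field (e.g. a layer `ℚ_n` of the
  cyclotomic `ℤ_p`-extension), `𝔭` a place of `K` above `v`: granted A40,
  `∃ u ∈ H¹_ur(K_𝔭, V[p])`, `u ∉ 𝓚_𝔭` for `V ⊗ K` — n1011-p10's `hwitn` at the split multiplicative
  Tamagawa places of every layer, with NO congruence condition on `N(v)` and no (L1) binder.

References: J.-P. Serre, Invent. Math. 15 (1972) n° 1.12; J.-P. Serre, Duke Math. J. 54 (1987)
(4.1.12); J. H. Silverman, *ATAEC* (1994) Cor. IV.9.2 (d), Thm. V.3.1, Thm. V.5.3, Ex. 5.13 (b);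
J. H. Silverman, *AEC* (2009) VII.1.3, VII.5.1; R. Greenberg, LNM 1716 (1999) §3 p. 74 and the
proof of Cor. 5.6.
-/

noncomputable section

open scoped Classical NumberField

open WeierstrassCurve NumberField IsDedekindDomain Rat.HeightOneSpectrum Field
  Literature.NumberTheory.EllipticCurves Literature.NumberTheory.GaloisRepresentations

namespace Summit.BirchSwinnertonDyer.Rank1Residual.Additive

/-! ## §1 (L1) in the `absInertia` currency, and the split-multiplicative witness over any `K` -/

section Local

variable {K : Type} [Field K] [NumberField K] (W : WeierstrassCurve K) [W.IsElliptic]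
  (p : ℕ) [hp : Fact p.Prime] (v : HeightOneSpectrum (𝓞 K))

/-- **(L1), `absInertia` form.** For an elliptic curve `E = W` over a number field `K`, a prime
`p`, and a finite place `v ∤ p` of multiplicative reduction with `p ∣ ord_v(Δ_min)`: every
`p`-torsion point of `E(K̄_v)` is fixed by the inertia group `absInertia K_v ≤ Γ_{K_v}` — the
binder `hI` of n1011-p16's `TateDataUnramifiedTorsion` / `SplitMultiplicativeBaseChange`.  This is
the tree's `WeierstrassCurve.smul_eq_of_mem_inertia_of_hasMultiplicativeReductionAt_of_dvd`
(Kodaira–Néron over `K_v^nr`, no Tate curve) read through `inertia_eq_absInertia`.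
[cite: SerreInventiones1972, n° 1.12] [cite: Serre1987, §4.1 (4.1.12)]
[cite: SilvermanATAEC1994, Cor. IV.9.2(d), V.4–V.5 and Exercise 5.13(b) (PDF p. 416)] -/
theorem forall_absInertia_smul_eq_of_dvd_ordMinimalDiscriminant
    (hmult : W.HasMultiplicativeReductionAt v) (hpv : ((p : ℕ) : 𝓞 K) ∉ v.asIdeal)
    (hdvd : p ∣ W.ordMinimalDiscriminant v) :
    ∀ Q : localPoints W (v.adicCompletion K), (p : ℤ) • Q = 0 →
      ∀ τ ∈ absInertia (v.adicCompletion K), τ • Q = Q := by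
  intro Q hQ τ hτ
  obtain ⟨w, hw⟩ := v.exists_spectralValuation
  obtain ⟨𝔐, h𝔐⟩ := v.localPrimesAbove_nonempty
  rw [← IsDedekindDomain.HeightOneSpectrum.inertia_eq_absInertia hw h𝔐] at hτ
  refine W.smul_eq_of_mem_inertia_of_hasMultiplicativeReductionAt_of_dvd hmult hp.out hpv hdvd hw
    h𝔐 hτ Q ?_
  rw [← natCast_zsmul]
  exact hQ

omit hp in
/-- **`p ∣ c_v ⟹ p ∣ ord_v(Δ_min)` at a split multiplicative place**: there
`c_v = ord_v(Δ_min)` (Kodaira–Néron, type `Iₙ`; tree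
`localTamagawaNumber_eq_ordMinimalDiscriminant_of_hasSplitMultiplicativeReductionAt`).
[cite: SilvermanATAEC1994, Cor. IV.9.2(d)] -/
theorem dvd_ordMinimalDiscriminant_of_dvd_localTamagawaNumber
    (hsplit : W.HasSplitMultiplicativeReductionAt v)
    (hc : p ∣ (W.baseChange (v.adicCompletion K)).localTamagawaNumber
      (v.adicCompletionIntegers K)) :
    p ∣ W.ordMinimalDiscriminant v := by
  rwa [localTamagawaNumber_eq_ordMinimalDiscriminant_of_hasSplitMultiplicativeReductionAt v W
    hsplit] at hc

/-- **(L1) from the census datum**: at a split multiplicative `v ∤ p` with `p ∣ c_v`, the inertia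
group fixes `E[p]` (previous two theorems). [cite: SilvermanATAEC1994, Cor. IV.9.2(d) and Exercise 5.13(b)]
[cite: SerreInventiones1972, n° 1.12] -/
theorem forall_absInertia_smul_eq_of_dvd_localTamagawaNumber
    (hsplit : W.HasSplitMultiplicativeReductionAt v) (hpv : ((p : ℕ) : 𝓞 K) ∉ v.asIdeal)
    (hc : p ∣ (W.baseChange (v.adicCompletion K)).localTamagawaNumber
      (v.adicCompletionIntegers K)) :
    ∀ Q : localPoints W (v.adicCompletion K), (p : ℤ) • Q = 0 →
      ∀ τ ∈ absInertia (v.adicCompletion K), τ • Q = Q :=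
  forall_absInertia_smul_eq_of_dvd_ordMinimalDiscriminant W p v hsplit.hasMultiplicativeReductionAt
    hpv (dvd_ordMinimalDiscriminant_of_dvd_localTamagawaNumber W p v hsplit hc)

/-- **THE SPLIT-MULTIPLICATIVE TAMAGAWA WITNESS FROM `p ∣ c_v`, MODULO TATE'S UNIFORMISATION
ONLY.** For `E = W` over ANY number field `K`, `p` prime, `v ∤ p` a place of split multiplicative
reduction with `p ∣ c_v` (`localTamagawaNumber` of `E ⊗ K_v`): granted the named fact
`Silverman1994_thmV53_tateUniformisation` (A40), `∃ u ∈ H¹_ur(K_v, E[p])`, `u ∉ 𝓚_v` — the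
per-place binder `hwit` / `hwitn` of n1011-p10's budget sockets.  Compared with n1011-p16's
`…_of_tateUniformisation_of_dvd_localTamagawaNumber` the hypothesis `μ_p(K_v) = 1` is GONE: the
places with `N(v) ≡ 1 (mod p)` are covered too (its `hI` is discharged by (L1) above).
CONDITIONAL on A40 (hypothesis `hU`) and on nothing else.
[cite: SilvermanATAEC1994, Ch. V Thm. 3.1 (c),(d) and Thm. 5.3 (a),(b)]
[cite: GreenbergLNM1716, §3 p. 74 and Cor. 5.6 (proof)] [cite: SerreInventiones1972, n° 1.12] -/
theorem exists_mem_unramifiedSubgroup_not_mem_kummerLocalConditionAt_of_tateUniformisation_of_split_of_dvd_localTamagawaNumber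
    (hU : Silverman1994_thmV53_tateUniformisation.{0})
    (hsplit : W.HasSplitMultiplicativeReductionAt v) (hpv : ((p : ℕ) : 𝓞 K) ∉ v.asIdeal)
    (hc : p ∣ (W.baseChange (v.adicCompletion K)).localTamagawaNumber
      (v.adicCompletionIntegers K)) :
    ∃ u ∈ DiscreteGaloisModule.unramifiedSubgroup
        ((W.torsionGaloisModule (p : ℤ)).restrictField (v.adicCompletion K)) 1,
      u ∉ W.kummerLocalConditionAt (p : ℤ) (v.adicCompletion K) :=
  W.exists_mem_unramifiedSubgroup_not_mem_kummerLocalConditionAt_of_tateUniformisation_of_torsion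
    v hU hsplit hpv (forall_absInertia_smul_eq_of_dvd_localTamagawaNumber W p v hsplit hpv hc)

end Local

/-! ## §2 Base change `ℚ → K`: `ord_𝔭 Δ_min(V ⊗ K) = e(𝔭|v) · ord_v Δ_min(V)` and the level-`K`
witness from the census datum over `ℚ` -/

section BaseChange

variable (V : WeierstrassCurve ℚ) [V.IsElliptic] [V.IsGloballyMinimal] (p : ℕ) [hp : Fact p.Prime]
  {v : HeightOneSpectrum (𝓞 ℚ)} {K : Type} [Field K] [NumberField K]
  (𝔭 : HeightOneSpectrum (𝓞 K))

omit hp in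
/-- A place `𝔭` of `K` above the place `v` of `ℚ` contains the rational prime under `v` (which
lies in `v`: tree `natCast_mem_asIdeal_iff_eq_primesEquiv_symm`, cf.
`BCDT.natCast_primesEquiv_mem_asIdeal`). [folklore] -/
theorem natCast_primesEquiv_mem_of_under_eq (h𝔭 : 𝔭.asIdeal.under (𝓞 ℚ) = v.asIdeal) :
    ((primesEquiv v : ℕ) : 𝓞 K) ∈ 𝔭.asIdeal := by
  have h : ((primesEquiv v : ℕ) : 𝓞 ℚ) ∈ v.asIdeal :=
    (natCast_mem_asIdeal_iff_eq_primesEquiv_symm v (primesEquiv v).2).mpr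
      (by rw [Subtype.coe_eta, Equiv.symm_apply_apply])
  rw [← h𝔭, Ideal.mem_comap, map_natCast] at h
  exact h

/-- **`ord_𝔭 Δ_min(V ⊗ K) = e(𝔭|v) · ord_v Δ_min(V)`** for `V/ℚ` globally minimal with split
multiplicative reduction at the place `v`, `K` a number field and `𝔭` a place of `K` above `v`:
the `ℤ`-minimal equation of `V` stays minimal at `𝔭` (`c₄` is a `v`-unit, hence a `𝔭`-unit;
additive-p2's `isMinimalAt_and_hasMultiplicativeReductionAt_baseChange_of_mult`), both minimal
discriminants are read on it (`valuation_Δ_eq_of_isMinimalAt_holds`), and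
`|x|_𝔭 = |x|_v^{e(𝔭|v)}` on `ℚ` (Mathlib `valuation_liesOver`).
[cite: SilvermanAEC2009, VII.1 Prop. 1.3(b) and Remark 1.1, VII.5 Prop. 5.1(b)] -/
theorem ordMinimalDiscriminant_baseChange_eq_mul_of_hasSplitMultiplicativeReductionAt
    (hsplit : V.HasSplitMultiplicativeReductionAt v) (h𝔭 : 𝔭.asIdeal.under (𝓞 ℚ) = v.asIdeal) :
    (V.baseChange K).ordMinimalDiscriminant 𝔭 =
      v.asIdeal.ramificationIdx' 𝔭.asIdeal * V.ordMinimalDiscriminant v := by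
  haveI : Fact (primesEquiv v : ℕ).Prime := ⟨(primesEquiv v).2⟩
  haveI : (V.baseChange K).IsElliptic := by rw [baseChange]; infer_instance
  haveI : 𝔭.asIdeal.LiesOver v.asIdeal := ⟨h𝔭.symm⟩
  -- split multiplicative at the rational prime `ℓ` under `v`, in the prime-indexed currency
  have hsplitP : V.HasSplitMultiplicativeReductionAtPrime (primesEquiv v : ℕ) :=
    (hasSplitMultiplicativeReductionAtPrime_iff_hasSplitMultiplicativeReductionAt V v).mpr hsplit
  have hℓ𝔭 := natCast_primesEquiv_mem_of_under_eq 𝔭 h𝔭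
  -- both equations are minimal: `V` at `v`, `V ⊗ K` at `𝔭`
  have hminQ : V.IsMinimalAt v := IsGloballyMinimal.isMinimalAt V v
  have hminK : (V.baseChange K).IsMinimalAt 𝔭 :=
    (isMinimalAt_and_hasMultiplicativeReductionAt_baseChange_of_mult V
      hsplitP.hasMultiplicativeReductionAtPrime 𝔭 hℓ𝔭).1
  have hΔQ := valuation_Δ_eq_of_isMinimalAt_holds v V hminQ
  have hΔK := valuation_Δ_eq_of_isMinimalAt_holds 𝔭 (V.baseChange K) hminK
  -- `Δ(V ⊗ K) = Δ(V)` and `|Δ|_𝔭 = |Δ|_v ^ e`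
  have hΔ : (V.baseChange K).Δ = algebraMap ℚ K V.Δ := by rw [baseChange, map_Δ]
  have hlies := IsDedekindDomain.HeightOneSpectrum.valuation_liesOver K v 𝔭 V.Δ
  rw [hΔQ, ← hΔ, hΔK, ← WithZero.exp_nsmul, WithZero.exp_inj, Int.nsmul_eq_mul] at hlies
  have h : ((V.baseChange K).ordMinimalDiscriminant 𝔭 : ℤ) =
      (v.asIdeal.ramificationIdx' 𝔭.asIdeal : ℤ) * (V.ordMinimalDiscriminant v : ℤ) := by
    linarith
  exact_mod_cast h

/-- Hence `ord_v Δ_min(V) ∣ ord_𝔭 Δ_min(V ⊗ K)`. [cite: SilvermanAEC2009, VII.1 Prop. 1.3(b)] -/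
theorem ordMinimalDiscriminant_dvd_ordMinimalDiscriminant_baseChange
    (hsplit : V.HasSplitMultiplicativeReductionAt v) (h𝔭 : 𝔭.asIdeal.under (𝓞 ℚ) = v.asIdeal) :
    V.ordMinimalDiscriminant v ∣ (V.baseChange K).ordMinimalDiscriminant 𝔭 :=
  ⟨v.asIdeal.ramificationIdx' 𝔭.asIdeal, by
    rw [ordMinimalDiscriminant_baseChange_eq_mul_of_hasSplitMultiplicativeReductionAt V 𝔭 hsplit h𝔭,
      mul_comm]⟩

/-- **(L1) at the places of `K` above a split multiplicative Tamagawa prime of `V/ℚ`**: for `V/ℚ`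
globally minimal, `v ∤ p` split multiplicative with `p ∣ c_v(V/ℚ)`, `K` a number field and `𝔭 ∣ v`:
the inertia group `absInertia K_𝔭` fixes every `p`-torsion point of `V(K̄_𝔭)` — the binder `hI` of
n1011-p16's `exists_mem_unramifiedSubgroup_not_mem_kummerLocalConditionAt_baseChange_of_torsion`
(FILE 6), DISCHARGED. [cite: SerreInventiones1972, n° 1.12]
[cite: SilvermanATAEC1994, Cor. IV.9.2(d) and Exercise 5.13(b)] -/
theorem forall_absInertia_smul_eq_baseChange_of_dvd_localTamagawaNumber
    (hpv : ((p : ℕ) : 𝓞 ℚ) ∉ v.asIdeal) (hsplit : V.HasSplitMultiplicativeReductionAt v)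
    (hc : p ∣ (V.baseChange (v.adicCompletion ℚ)).localTamagawaNumber (v.adicCompletionIntegers ℚ))
    (h𝔭 : 𝔭.asIdeal.under (𝓞 ℚ) = v.asIdeal) :
    ∀ Q : localPoints (V.baseChange K) (𝔭.adicCompletion K), (p : ℤ) • Q = 0 →
      ∀ τ ∈ absInertia (𝔭.adicCompletion K), τ • Q = Q := by
  haveI : Fact (primesEquiv v : ℕ).Prime := ⟨(primesEquiv v).2⟩
  haveI : (V.baseChange K).IsElliptic := by rw [baseChange]; infer_instance
  have hsplitP : V.HasSplitMultiplicativeReductionAtPrime (primesEquiv v : ℕ) :=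
    (hasSplitMultiplicativeReductionAtPrime_iff_hasSplitMultiplicativeReductionAt V v).mpr hsplit
  have hℓ𝔭 := natCast_primesEquiv_mem_of_under_eq 𝔭 h𝔭
  -- `V ⊗ K` is (split) multiplicative at `𝔭`, `𝔭 ∤ p`, and `p ∣ ord_𝔭 Δ_min(V ⊗ K)`
  have hmultK : (V.baseChange K).HasMultiplicativeReductionAt 𝔭 :=
    (isMinimalAt_and_hasMultiplicativeReductionAt_baseChange_of_mult V
      hsplitP.hasMultiplicativeReductionAtPrime 𝔭 hℓ𝔭).2
  have hp𝔭 : ((p : ℕ) : 𝓞 K) ∉ 𝔭.asIdeal := fun h ↦ hpv (by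
    rw [← h𝔭, Ideal.mem_comap, map_natCast]; exact h)
  have hdvd : p ∣ (V.baseChange K).ordMinimalDiscriminant 𝔭 :=
    (dvd_ordMinimalDiscriminant_of_dvd_localTamagawaNumber V p v hsplit hc).trans
      (ordMinimalDiscriminant_dvd_ordMinimalDiscriminant_baseChange V 𝔭 hsplit h𝔭)
  exact forall_absInertia_smul_eq_of_dvd_ordMinimalDiscriminant (V.baseChange K) p 𝔭 hmultK hp𝔭
    hdvd

/-- **THE LEVEL-`K` TAMAGAWA WITNESS FROM THE CENSUS DATUM OVER `ℚ`.** For `V/ℚ` globally minimal,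
`p` prime, `v ∤ p` a place of split multiplicative reduction with `p ∣ c_v(V/ℚ)`, `K` ANY number
field (e.g. a layer `ℚ_n = κ.layer n` of the cyclotomic `ℤ_p`-extension) and `𝔭` a place of `K`
above `v`: granted `Silverman1994_thmV53_tateUniformisation` (A40),
`∃ u ∈ H¹_ur(K_𝔭, V[p])`, `u ∉ 𝓚_𝔭` for `V ⊗ K` — n1011-p10's binder `hwitn` at the split
multiplicative Tamagawa places of the layer, with NO congruence condition on `N(v)` and NO (L1)
binder (split multiplicative reduction persists at `𝔭`: n1011-p16's
`hasSplitMultiplicativeReductionAt_baseChange_of_hasSplitMultiplicativeReductionAtPrime`; `hI`: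
the previous theorem).  CONDITIONAL on A40 (hypothesis `hU`) only.
[cite: SilvermanATAEC1994, Ch. V Thm. 3.1 (c),(d) and Thm. 5.3 (a),(b)]
[cite: GreenbergLNM1716, §3 p. 74 and Cor. 5.6 (proof)] [cite: SerreInventiones1972, n° 1.12] -/
theorem exists_mem_unramifiedSubgroup_not_mem_kummerLocalConditionAt_baseChange_of_split_of_dvd_localTamagawaNumber
    (hU : Silverman1994_thmV53_tateUniformisation.{0})
    (hpv : ((p : ℕ) : 𝓞 ℚ) ∉ v.asIdeal) (hsplit : V.HasSplitMultiplicativeReductionAt v)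
    (hc : p ∣ (V.baseChange (v.adicCompletion ℚ)).localTamagawaNumber (v.adicCompletionIntegers ℚ))
    (h𝔭 : 𝔭.asIdeal.under (𝓞 ℚ) = v.asIdeal) :
    ∃ u ∈ DiscreteGaloisModule.unramifiedSubgroup
        (((V.baseChange K).torsionGaloisModule (p : ℤ)).restrictField (𝔭.adicCompletion K)) 1,
      u ∉ (V.baseChange K).kummerLocalConditionAt (p : ℤ) (𝔭.adicCompletion K) := by
  haveI : Fact (primesEquiv v : ℕ).Prime := ⟨(primesEquiv v).2⟩
  haveI : (V.baseChange K).IsElliptic := by rw [baseChange]; infer_instance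
  have hsplitP : V.HasSplitMultiplicativeReductionAtPrime (primesEquiv v : ℕ) :=
    (hasSplitMultiplicativeReductionAtPrime_iff_hasSplitMultiplicativeReductionAt V v).mpr hsplit
  have hℓ𝔭 := natCast_primesEquiv_mem_of_under_eq 𝔭 h𝔭
  have hp𝔭 : ((p : ℕ) : 𝓞 K) ∉ 𝔭.asIdeal := fun h ↦ hpv (by
    rw [← h𝔭, Ideal.mem_comap, map_natCast]; exact h)
  exact (V.baseChange K).exists_mem_unramifiedSubgroup_not_mem_kummerLocalConditionAt_of_tateUniformisation_of_torsion
    𝔭 hU (hasSplitMultiplicativeReductionAt_baseChange_of_hasSplitMultiplicativeReductionAtPrime V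
      (primesEquiv v : ℕ) 𝔭 hℓ𝔭 hsplitP) hp𝔭
    (forall_absInertia_smul_eq_baseChange_of_dvd_localTamagawaNumber V p 𝔭 hpv hsplit hc h𝔭)

/-- The same with the place-level hypothesis `𝔭.under (𝓞 ℚ) = v` (the form of n1011-p10's
`exists_finset_placesOver_card_ge` / n1011-p01's place counts). [cite: SilvermanATAEC1994, Ch. V Thm. 3.1 (c),(d) and Thm. 5.3 (a),(b)]
[cite: GreenbergLNM1716, §3 p. 74 and Cor. 5.6 (proof)] -/
theorem exists_mem_unramifiedSubgroup_not_mem_kummerLocalConditionAt_baseChange_of_split_of_dvd_localTamagawaNumber'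
    (hU : Silverman1994_thmV53_tateUniformisation.{0})
    (hpv : ((p : ℕ) : 𝓞 ℚ) ∉ v.asIdeal) (hsplit : V.HasSplitMultiplicativeReductionAt v)
    (hc : p ∣ (V.baseChange (v.adicCompletion ℚ)).localTamagawaNumber (v.adicCompletionIntegers ℚ))
    (h𝔭 : 𝔭.under (𝓞 ℚ) = v) :
    ∃ u ∈ DiscreteGaloisModule.unramifiedSubgroup
        (((V.baseChange K).torsionGaloisModule (p : ℤ)).restrictField (𝔭.adicCompletion K)) 1,
      u ∉ (V.baseChange K).kummerLocalConditionAt (p : ℤ) (𝔭.adicCompletion K) :=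
  exists_mem_unramifiedSubgroup_not_mem_kummerLocalConditionAt_baseChange_of_split_of_dvd_localTamagawaNumber
    V p 𝔭 hU hpv hsplit hc (by
      have h := congrArg HeightOneSpectrum.asIdeal h𝔭
      rw [HeightOneSpectrum.under_asIdeal] at h
      exact h)

end BaseChange

end Summit.BirchSwinnertonDyer.Rank1Residual.Additive

end
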